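import Summits.NavierStokesRegularity.NavierStokesRegularity.Theses.FilamentSkeletonRss

/-!
# Line `child_tangent_analytic_strip` — child crux `TangentSkeletonNearStraight` (stmt-NavierStokesRegularity-28295)
# of `SkeletonJ1G` (stmt-27849), route `FilamentSkeletonRss`

Crux-strategist gen 2 (`cstrat-stmt-NavierStokesRegularity-27849-s1-g2`), 2026-08-28.  After the rev-32 SPLIT of the deciding
∃-crux `SkeletonJ1G` into `TangentSkeletonNearStraight ∧ Clause13NearStraight ∧ NormalBlockMatched` (glue item
`SkeletonJ1GOfNearStraightParts`, proved in `Cruxes/SkeletonJ1G/SplitGlueRoute.lean`), the XL child — the existence of an EXACTLY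
TANGENT near-straight core-matched skeleton from a general-position straight skew datum — gets its own skeleton slot.  This file is
the skeleton for THAT CHILD, cut exactly as gen-1's alternative line `Cruxes/SkeletonJ1G/Lines/analytic_strip_newton.lean`
(planner-cstrat-…-27849-s1-0) cuts the existence step: its objects (§2), stub statements and stub docstrings are copied LETTER FOR
LETTER from that file, with ONE change — the output statement `TangentSkeletonAnalytic` carries the child's general-position
hypothesis `|⟪t j, t k⟫| ≤ 1 − θ₀ (j ≠ k)`.  The registered skeleton of the PARENT (`Cruxes/SkeletonJ1/Lines/near_straight_newton.lean`,
sha16 `425a2bdc735ccf75`) is untouched; its stub S2 `TangentSkeletonFromStraight` also closes this child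
(`SplitGlueRoute.tangentSkeletonNearStraight_of_fromStraight'`), so a prover may attack the child EITHER by the registered L^∞
three-regime Newton step OR by this line.

THE LEVER (gen-1, verbatim in substance): wide-strip analyticity.  Every datum of the tangency problem is real-analytic in a complex
strip of width `~ cs·√Γ` around each filament's parameter axis, and the regularised Biot–Savart centreline field PRESERVES such
strips (`StripPropagation`, contour shift).  In strip norms the local-induction operator is an operator-accurate preconditioner of
the exact regularised self-induction, whose static symbol is `(2/μ²)·𝔖(kμ)`, `𝔖(x) = ∫₀^∞ (1 − cos xh − xh sin xh)(1+h²)^{-3/2} dh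
= 1 − xK₁(x) − x²K₀(x)` (`LiaSymbolBound`: `𝔖 ≤ x²/12`, `𝔖 ≥ −x²/3` on `[½,∞)`, Klein–Majda small-`x` asymptotics); high modes
(including the core-scale turning band `kμ ≈ 1.11`) are paid for by strip width.  Two-phase scheme: `O(log Γ)` preconditioned steps
in shrinking strips to residual `2^{-cΓ^{1/4}}`, then Newton–Kantorovich with merely polynomial-in-Γ linear bounds
(`AnalyticNewtonClosing`, THE hard stub).  General position enters PHASE 1: for an (anti)parallel pair the odd in-ball
`S`-bending `≈ (A/6)·Rb³·√(log Γ)` waist units is not a small correction of the datum at a tolerance fixed after the datum; with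
`|⟪t j, t k⟫| ≤ 1 − θ₀` the first iterate (cut-off local-induction arc, `Theorems.SelectionBoxRJRung.modelArc_rung`) is already
`O(Rb)`-close in tangent to an admissible skeleton.

STUBS (the ONLY sorries; 3): `stub_stripPropagation` (M–L) · `stub_liaSymbol` (S–M, numerically certified by gen-1) ·
`stub_analyticClosing` (L–XL, THE hard stub).  `TangentSkeletonNearStraight_of : Theses.FilamentSkeletonRss.TangentSkeletonNearStraight`
is the only theorem concluding the child decl, BY NAME; the glue `tangentSkeletonNearStraightP_of_hyps` + `tangentSkeletonNearStraight_iff` is sorry-free.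
HONEST FRAMING: a plan for a HYPOTHETICAL filament skeleton on the NEGATIVE side of a MODEL route; nothing in this file bears on
Navier–Stokes regularity or blow-up.
-/

set_option linter.dupNamespace false
set_option linter.unusedVariables false

noncomputable section

namespace Summit.NavierStokesRegularity.NavierStokesRegularity.Cruxes.TangentSkeletonNearStraight.AnalyticStrip

open scoped BigOperators Topology InnerProductSpace
open Filter Set Function MeasureTheory
open Literature.Analysis.FluidPDE

/-! ## §1  Piece predicates of the registered parent skeleton, verbatim (shared with `SplitGlueRoute.lean`) -/

/-- FLAT PART of the matrix: clauses 0–11, the area law and the Γ-flat cone bound, verbatim. [folklore] -/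
def FlatJ1G (N : ℕ) (δ ρ K Λ Rw Rb cg θ₀ KA Γ : ℝ) (γ : Fin N → ℝ) (α : ℝ) (X : Fin N → ℝ → EuclideanSpace ℝ (Fin 3))
    (w : Fin N → ℝ → ℝ) (c : Fin N → ℝ) (Aa : Fin N → ℝ → ℝ) : Prop :=
  ∀ (u:(Fin N → ℝ → EuclideanSpace ℝ (Fin 3)) → EuclideanSpace ℝ (Fin 3) → EuclideanSpace ℝ (Fin 3)) (v:EuclideanSpace ℝ (Fin 3) → EuclideanSpace ℝ (Fin 3)) (A:Fin N → (EuclideanSpace ℝ (Fin 3) →L[ℝ] EuclideanSpace ℝ (Fin 3))) (T:(Fin N → ℝ → EuclideanSpace ℝ (Fin 3)) → Fin N → ℝ → EuclideanSpace ℝ (Fin 3)), (∀ Z y, u Z y = ∑ k, (Γ*γ k/(4*Real.pi))•∫ σ:ℝ, ((‖y-Z k σ‖^2+Real.exp (-(1+Real.eulerMascheroniConstant-Real.log 2))*Aa k σ)^(3/2:ℝ))⁻¹•cross (deriv (Z k) σ) (y-Z k σ))→(∀ y, v y = u X y+(1/2:ℝ)•y-α•cross (EuclideanSpace.single 2 1)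 y)→(∀ j, A j = fderiv ℝ v (X j (c j)))→(∀ Z j τ, T Z j τ = (u Z (Z j τ)+(1/2:ℝ)•Z j τ-α•cross (EuclideanSpace.single 2 1) (Z j τ))-(⟪u Z (Z j τ)+(1/2:ℝ)•Z j τ-α•cross (EuclideanSpace.single 2 1) (Z j τ), deriv (Z j) τ⟫_ℝ/‖deriv (Z j) τ‖^2)•deriv (Z j) τ)→(α ≠ 0 ∧ (∀ j, γ j ≠ 0) ∧ (∀ j, ContDiff ℝ 2 (X j) ∧ Differentiable ℝ (w j)∧(∀ τ, ‖deriv (X j) τ‖ = 1)∧(∀ τ, ‖iteratedDeriv 2 (X j) τ‖*√Γ≤K) ∧ Tendsto (fun τ => ‖X j τ‖) (cocompact ℝ) atTop) ∧ (∀ j k, j ≠ k → ∀ τ σ, ρ*√Γ≤‖X j τ-X k σ‖) ∧ (∀ j τ σ, ρ*√Γ≤|τ-σ| → cg*ρ*√Γ≤‖X j τ-X j σ‖) ∧ (∀ j τ, cg*|τ-c j|≤Rw*√Γ+‖X j τ‖) ∧ (∀ j τ, w j τ = ⟪v (X j τ), deriv (X j) τ⟫_ℝ) ∧ (∀ j τ,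 ‖X j τ‖≤Rb*√(Γ*Real.log Γ) → v (X j τ) = w j τ•deriv (X j) τ) ∧ (∀ j, ‖X j (c j)‖≤Rw*√Γ) ∧ (∀ j, |⟪deriv (X j) (c j), EuclideanSpace.single 2 1⟫_ℝ|≤1-θ₀) ∧ (θ₀≤|α| ∧ |α|≤θ₀⁻¹ ∧ ∀ j, θ₀≤|γ j| ∧ |γ j|≤θ₀⁻¹) ∧ (∀ j, w j (c j) = 0 ∧ (∀ τ, w j τ = 0 → τ = c j) ∧ 3/2+δ≤deriv (w j) (c j) ∧ deriv (w j) (c j)≤Λ) ∧ (∀ j, Differentiable ℝ (Aa j) ∧ (∀ τ, 0 < Aa j τ) ∧ ∀ τ, w j τ*deriv (Aa j) τ = (3/2-deriv (w j) τ)*Aa j τ+4) ∧ (∀ j τ, Rw^2*Γ*Aa j τ≤KA*(Rw^2*Γ+‖X j τ‖^2)))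

/-- THE NEAR-STRAIGHT REGIME: tangent oscillation `≤ Rb`, global slip-slope bound, core-area floor. [folklore] -/
def NearStraightJ1G (N : ℕ) (Λ Rb : ℝ) (X : Fin N → ℝ → EuclideanSpace ℝ (Fin 3)) (w : Fin N → ℝ → ℝ) (Aa : Fin N → ℝ → ℝ) : Prop :=
  (∀ j τ σ, ‖deriv (X j) τ - deriv (X j) σ‖ ≤ Rb) ∧ (∀ j τ, |deriv (w j) τ| ≤ Λ) ∧ (∀ j τ, Λ⁻¹ ≤ Aa j τ)

/-- A STRAIGHT SKEW DATUM (Γ-free, finite-dimensional), verbatim from the registered line. [folklore] -/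
def StraightDatum (N : ℕ) (δ ρ Λ Rw θ₀ mw : ℝ) (p t : Fin N → EuclideanSpace ℝ (Fin 3)) (γ : Fin N → ℝ) (α : ℝ)
    (s₀ : Fin N → ℝ) : Prop :=
  (∀ j, ‖t j‖ = 1) ∧ (∀ j k, j ≠ k → ∀ τ σ : ℝ, ρ ≤ ‖(p j + τ • t j) - (p k + σ • t k)‖) ∧ (∀ j, |⟪t j, EuclideanSpace.single 2 1⟫_ℝ| ≤ 1 - θ₀) ∧ (θ₀ ≤ |α| ∧ |α| ≤ θ₀⁻¹ ∧ ∀ j, θ₀ ≤ |γ j| ∧ |γ j| ≤ θ₀⁻¹) ∧ (∀ j, ‖p j + s₀ j • t j‖ ≤ Rw) ∧ (∀ W : Fin N → ℝ → ℝ, (∀ j s, W j s = ⟪(∑ k ∈ Finset.univ.erase j, (γ k / (2 * Real.pi)) • ((‖(p j + s • t j - p k) - ⟪p j + s • t j - p k, t k⟫_ℝ • t k‖ ^ 2)⁻¹ • cross (t k) ((p j + s • t j - p k) - ⟪p j + s • t j - p k, t k⟫_ℝ • t k))) + (1 / 2 : ℝ) • (p j + s • t j) - α • cross (EuclideanSpace.single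 2 1) (p j + s • t j), t j⟫_ℝ) → ∀ j, W j (s₀ j) = 0 ∧ (∀ s, mw * |s - s₀ j| ≤ |W j s|) ∧ 3 / 2 + δ ≤ deriv (W j) (s₀ j) ∧ (∀ s, |deriv (W j) s| ≤ Λ))

/-! ## §1b  The child, structured -/

/-- The child crux in structured form (= `SplitGlueRoute.TangentSkeletonNearStraightP`, and definitionally the route decl
`Theses.FilamentSkeletonRss.TangentSkeletonNearStraight`, see `tangentSkeletonNearStraight_iff`). -/
def TangentSkeletonNearStraightP : Prop :=
  ∀ (N : ℕ) (δd ρd Λd Rwd θd mw : ℝ) (p t : Fin N → EuclideanSpace ℝ (Fin 3)) (γ : Fin N → ℝ) (α : ℝ) (s₀ : Fin N → ℝ),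
    0 < N → 0 < δd → 0 < ρd → 0 < Rwd → 0 < θd → 0 < mw → StraightDatum N δd ρd Λd Rwd θd mw p t γ α s₀ →
    (∀ j k, j ≠ k → |⟪t j, t k⟫_ℝ| ≤ 1 - θd) →
    ∃ (δ ρ K Λ Rw cg θ₀ KA Rb₁ : ℝ), 0 < δ ∧ 0 < ρ ∧ 0 < Rw ∧ 0 < cg ∧ 0 < θ₀ ∧ 0 < Rb₁ ∧
      2 * K * ρ ≤ 1 ∧ ∀ Rb : ℝ, 0 < Rb → Rb ≤ Rb₁ → ∃ Γ₂ : ℝ, ∀ Γ : ℝ, Γ₂ ≤ Γ →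
        ∃ (X : Fin N → ℝ → EuclideanSpace ℝ (Fin 3)) (w : Fin N → ℝ → ℝ) (c : Fin N → ℝ) (Aa : Fin N → ℝ → ℝ),
          FlatJ1G N δ ρ K Λ Rw Rb cg θ₀ KA Γ γ α X w c Aa ∧ NearStraightJ1G N Λ Rb X w Aa


/-! ## §2  New objects of this line: stadium analyticity, the exact local-induction symbol -/

/-- Complexification of a point of `ℝ³` (coordinates through the standard basis). -/
def cplx (y : EuclideanSpace ℝ (Fin 3)) : Fin 3 → ℂ :=
  fun i => ((⟪y, EuclideanSpace.single i (1:ℝ)⟫_ℝ : ℝ) : ℂ)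

/-- The STADIUM of half-width `hs` around the parameter segment `|Re z − cc| < L + hs`: the complex neighbourhood of the
(enlarged) exactness-ball segment of one filament on which analyticity is asserted. -/
def Stadium (hs L cc : ℝ) : Set ℂ := {z : ℂ | |z.im| < hs ∧ |z.re - cc| < L + hs}

/-- A STADIUM-ANALYTIC CURVE: `X` has a complex-analytic extension to the stadium whose derivative is bounded by `2`
(real unit speed continues to `⟨F′,F′⟩ = 1` bilinearly; the bound `2` is slack for the imaginary directions). -/
def StadiumAnalyticCurve (hs L cc : ℝ) (X : ℝ → EuclideanSpace ℝ (Fin 3)) : Prop :=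
  ∃ F : ℂ → (Fin 3 → ℂ), DifferentiableOn ℂ F (Stadium hs L cc) ∧
    (∀ t : ℝ, (t : ℂ) ∈ Stadium hs L cc → F t = cplx (X t)) ∧
    ∀ z ∈ Stadium hs L cc, ‖deriv F z‖ ≤ 2

/-- A STADIUM-ANALYTIC CORE AREA: the positive function `A` has an analytic extension to the stadium with real part at
least half, and modulus at most twice, its value at the real foot — what keeps the matched kernel
`(‖y − Z‖² + e^{−(1+γ_E−log 2)}·A)^{-3/2}` on its principal branch under the simultaneous contour shift. -/
def StadiumAnalyticArea (hs L cc : ℝ) (A : ℝ → ℝ) : Prop :=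
  ∃ G : ℂ → ℂ, DifferentiableOn ℂ G (Stadium hs L cc) ∧
    (∀ t : ℝ, (t : ℂ) ∈ Stadium hs L cc → G t = ((A t : ℝ) : ℂ)) ∧
    ∀ z ∈ Stadium hs L cc, A z.re / 2 ≤ (G z).re ∧ ‖G z‖ ≤ 2 * A z.re

/-- A STADIUM-ANALYTIC BOUNDED vector function (used for the induced velocity along a filament). -/
def StadiumAnalyticBdd (hs L cc B : ℝ) (f : ℝ → EuclideanSpace ℝ (Fin 3)) : Prop :=
  ∃ U : ℂ → (Fin 3 → ℂ), DifferentiableOn ℂ U (Stadium hs L cc) ∧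
    (∀ t : ℝ, (t : ℂ) ∈ Stadium hs L cc → U t = cplx (f t)) ∧
    ∀ z ∈ Stadium hs L cc, ‖U z‖ ≤ B

/-- THE EXACT STATIC SELF-INDUCTION SYMBOL of the crux's algebraic (Rosenhead–Moore) kernel, core scale normalised to `1`:
`𝔖(x) = ∫₀^∞ (1 − cos(xh) − xh·sin(xh))·(1+h²)^{-3/2} dh` (`= 1 − x·K₁(x) − x²·K₀(x)` in modified Bessel functions;
Mathlib has no `K_ν`, so the integral is the definition).  The linearised normal self-induced velocity of a straight
matched-core filament displaced by `ξ̂ e^{ikτ}` is `(Γγ/4π)·(2/μ²)·𝔖(kμ)·t × ξ̂ e^{ikτ}`; local induction replaces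
`𝔖(kμ)` by `−(kμ)²·L̃/2`. -/
def liaSym (x : ℝ) : ℝ :=
  ∫ h in Set.Ioi (0:ℝ), (1 - Real.cos (x * h) - x * h * Real.sin (x * h)) * ((1 + h ^ 2) ^ (3 / 2 : ℝ))⁻¹

/-! ## §3  The new stub statements -/

/-- STUB P2 statement · STRIP PROPAGATION.  Along an `N`-tuple of unit-speed, near-straight (tangent oscillation `≤ Rb`),
`ρ√Γ`-separated, chord-arc filaments with core areas in `[Λ⁻¹, KA(1+Γ+‖X‖²)]`, each stadium-analytic of half-width
`cs√Γ` (`8cs ≤ ρ`) around its ball segment together with its core area, the matched Biot–Savart centreline field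
`τ ↦ u X (X j τ)` is stadium-analytic on the quarter-width stadium with the Γ-uniform bound `Cu·√Γ·log Γ`.  (Contour
shift `τ ↦ τ+iy` jointly with `σ ↦ σ+iy` near the diagonal — translation invariance of the kernel in the parameter —
and no shift far from it; `Cu` depends on the listed constants only.) -/
def StripPropagation : Prop :=
  ∀ (N : ℕ) (ρ K Λ Rb cg θ₀ KA cs : ℝ), 0 < N → 0 < ρ → 0 < Λ → 0 < Rb → Rb ≤ 1/2 → 0 < cg → 0 < θ₀ → 0 < KA →
    0 < cs → 8 * cs ≤ ρ →
    ∃ (Cu Γ₀ : ℝ), 0 < Cu ∧ ∀ Γ : ℝ, Γ₀ ≤ Γ →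
      ∀ (γ : Fin N → ℝ) (X : Fin N → ℝ → EuclideanSpace ℝ (Fin 3)) (c : Fin N → ℝ) (Aa : Fin N → ℝ → ℝ)
        (u : (Fin N → ℝ → EuclideanSpace ℝ (Fin 3)) → EuclideanSpace ℝ (Fin 3) → EuclideanSpace ℝ (Fin 3)),
        (∀ Z y, u Z y = ∑ k, (Γ*γ k/(4*Real.pi))•∫ σ:ℝ, ((‖y-Z k σ‖^2+Real.exp (-(1+Real.eulerMascheroniConstant-Real.log 2))*Aa k σ)^(3/2:ℝ))⁻¹•cross (deriv (Z k) σ) (y-Z k σ)) →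
        (∀ j, |γ j| ≤ θ₀⁻¹) →
        (∀ j, ContDiff ℝ 2 (X j) ∧ (∀ τ, ‖deriv (X j) τ‖ = 1) ∧ (∀ τ, ‖iteratedDeriv 2 (X j) τ‖ * √Γ ≤ K) ∧
          ∀ τ σ, ‖deriv (X j) τ - deriv (X j) σ‖ ≤ Rb) →
        (∀ j k, j ≠ k → ∀ τ σ, ρ * √Γ ≤ ‖X j τ - X k σ‖) →
        (∀ j τ σ, ρ * √Γ ≤ |τ - σ| → cg * ρ * √Γ ≤ ‖X j τ - X j σ‖) →
        (∀ j, Differentiable ℝ (Aa j) ∧ (∀ τ, Λ⁻¹ ≤ Aa j τ) ∧ ∀ τ, Aa j τ ≤ KA * (1 + Γ + ‖X j τ‖ ^ 2)) →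
        (∀ j, StadiumAnalyticCurve (cs * √Γ) (Rb * √(Γ * Real.log Γ)) (c j) (X j)) →
        (∀ j, StadiumAnalyticArea (cs * √Γ) (Rb * √(Γ * Real.log Γ)) (c j) (Aa j)) →
        ∀ j, StadiumAnalyticBdd (cs * √Γ / 4) (Rb * √(Γ * Real.log Γ)) (c j) (Cu * √Γ * Real.log Γ)
          (fun τ => u X (X j τ))

/-- STUB P3 statement · THE LOCAL-INDUCTION MULTIPLIER BOUND (the cheap decisive stub; pure real analysis, kit-certifiable).
(a) the exact symbol never exceeds `x²/12` (numerically `sup 𝔖/x² = 0.0686` at `x ≈ 2.34`): in the anti-local-induction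
direction the exact self-induction is at most `(1/6)/L̃` of the local-induction stiffness; (b) `𝔖 ≥ −x²/3` beyond
`x = ½` (numerically `min 𝔖 = −0.0616` at `x ≈ 0.6`); (c) the local-induction asymptotics with the Klein–Majda constant,
`𝔖(x) = x²·((log(x/2)+γ_E)/2 + 1/4) + O(x⁴ log x)` on `(0, ½]` (numerically the remainder is `≤ 0.196·x⁴(|log x|+1)`).
Together: the modified-Newton multiplier `1 + 2𝔖(kμ)/((kμ)² L̃)` lies in `[0, 1 + (1/6)/L̃]` for `k ≥ 1/L_ball` and is
`≤ ½` for `k ≤ k₁`. -/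
def LiaSymbolBound : Prop :=
  (∀ x : ℝ, 0 < x → liaSym x ≤ x ^ 2 / 12) ∧
  (∀ x : ℝ, 1 / 2 ≤ x → -(x ^ 2 / 3) ≤ liaSym x) ∧
  (∀ x : ℝ, 0 < x → x ≤ 1 / 2 →
    |liaSym x - x ^ 2 * ((Real.log (x / 2) + Real.eulerMascheroniConstant) / 2 + 1 / 4)| ≤ x ^ 4 * (|Real.log x| + 1))

/-- OUTPUT of the existence step in this line: the child `TangentSkeletonNearStraight` (general-position datum ⇒ exactly
tangent near-straight skeleton) STRENGTHENED by stadium-analyticity of the skeleton curves and of their core areas (half-width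
`cs√Γ` around each ball segment) — the invariant the two-phase scheme propagates, exported so that later consumers may use it.
(Differs from gen-1's `analytic_strip_newton.TangentSkeletonAnalytic` only by the general-position hypothesis
`|⟪t j, t k⟫| ≤ 1 − θ₀`, which the child carries and which a perturbative scheme needs for (anti)parallel pairs.) -/
def TangentSkeletonAnalytic : Prop :=
  ∀ (N : ℕ) (δ ρ Λ Rw θ₀ mw : ℝ) (p t : Fin N → EuclideanSpace ℝ (Fin 3)) (γ : Fin N → ℝ) (α : ℝ) (s₀ : Fin N → ℝ),
    0 < N → 0 < δ → 0 < ρ → 0 < Rw → 0 < θ₀ → 0 < mw → StraightDatum N δ ρ Λ Rw θ₀ mw p t γ α s₀ →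
    (∀ j k, j ≠ k → |⟪t j, t k⟫_ℝ| ≤ 1 - θ₀) →
    ∃ (δ' ρ' K Λ' Rw' cg θ₀' KA Rb₁ cs : ℝ), 0 < δ' ∧ 0 < ρ' ∧ 0 < Rw' ∧ 0 < cg ∧ 0 < θ₀' ∧ 0 < Rb₁ ∧ 0 < cs ∧
      2 * K * ρ' ≤ 1 ∧ ∀ Rb : ℝ, 0 < Rb → Rb ≤ Rb₁ → ∃ Γ₂ : ℝ, ∀ Γ : ℝ, Γ₂ ≤ Γ →
        ∃ (X : Fin N → ℝ → EuclideanSpace ℝ (Fin 3)) (w : Fin N → ℝ → ℝ) (c : Fin N → ℝ) (Aa : Fin N → ℝ → ℝ),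
          FlatJ1G N δ' ρ' K Λ' Rw' Rb cg θ₀' KA Γ γ α X w c Aa ∧ NearStraightJ1G N Λ' Rb X w Aa ∧
          (∀ j, StadiumAnalyticCurve (cs * √Γ) (Rb * √(Γ * Real.log Γ)) (c j) (X j)) ∧
          (∀ j, StadiumAnalyticArea (cs * √Γ) (Rb * √(Γ * Real.log Γ)) (c j) (Aa j))

/-- STUB P5 statement · ANALYTIC NEWTON CLOSING (THE hard stub of this line): strip propagation and the multiplier bound
imply the stadium-analytic tangent skeleton from any general-position straight datum.  Internal steps (named in the line card, to be
attached `--supports`): (i) first iterate = cut-off local-induction arc (`modelArc_rung`); (ii) PHASE 1 — `O(log Γ)`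
local-induction-preconditioned steps, factor `½` per step at strip cost `≈ 0.87√(μ L_ball)` each; (iii) PHASE 2 — the
exact joint (curve ⊕ area-law) linearisation on the enlarged ball interval has a right inverse with POLYNOMIAL bound
`Γ^p` between stadium norms (bending dominance `1/Rb²` at ball scale, multiplier ellipticity between, transport at group
velocity `~Γ/μ` across the turning band `kμ ≈ 1.11`, hyperbolic normal block at the stagnation box); (iv) Newton–
Kantorovich from residual `2^{-cΓ^{1/4}}`; (v) far arms DESIGNED (C², non-analytic beyond the stadium; escape, chord-arc,
slip-sign, area law and cone bound are inequalities checked on the design, `Aa ∼ C τ²`). -/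
def AnalyticNewtonClosing : Prop :=
  StripPropagation → LiaSymbolBound → TangentSkeletonAnalytic

/-! ## §4  The stubs (the ONLY sorries of this file) -/

/-- STUB P2 · `stub_stripPropagation` · M–L · contour shift for the matched Biot–Savart integral: near the diagonal shift
`σ` with `τ` (the bilinear square `(τ−σ)²(1+O(Rb)) + c·G(σ+iy)` keeps positive real part by `StadiumAnalyticArea`), far
from it do not shift (`|Re τ − σ| ≥ cs√Γ/4 > |Im τ|` and near-straightness give positive real part), partners are never
shifted (`8cs ≤ ρ`).  Why it might fail: the quarter-width loss may be insufficient near the stadium ends for the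
curvature term (Cauchy estimates `‖F″‖ ≤ 8/(cs√Γ)` only on the half-stadium) — then shrink to `cs√Γ/8`, harmless
downstream. [Duchon–Robert 1988 doi:10.1016/0022-0396(88)90105-2 (the move); Majda–Bertozzi 2002 §7.1] -/
theorem stub_stripPropagation : StripPropagation := by
  sorry

/-- STUB P3 · `stub_liaSymbol` · S–M · three inequalities for `𝔖(x) = 1 − xK₁(x) − x²K₀(x)`, certified numerically by this
seat (pure-python Bessel quadrature, cross-checked against direct quadrature of the defining integral and against the
registered line's symbol table): `sup 𝔖/x² = 0.0686 < 1/12`, `𝔖 ≥ −0.0616 ≥ −x²/3` on `[½,∞)`, remainder ratio `≤ 0.196 < 1`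
on `(0,½]`.  Formal route: `∫₀^∞ cos(xh)(1+h²)^{-3/2} = xK₁(x)`, `∫₀^∞ h sin(xh)(1+h²)^{-3/2} = xK₀(x)` via the integral
representation `K_ν(x) = ∫₀^∞ e^{−x cosh t} cosh(νt) dt`, series with remainder on `(0,½]`, monotonicity/interval
arithmetic on `[½, 12]`, tail bound beyond.  Why it might fail: only the constants (margins 4 %, 5 %, 25 % → restate with
`1/10`, `−x²/2`, `2x⁴(…)` if a certified evaluation disagrees; the mechanism needs any fixed constants).
[Majda–Bertozzi 2002 p. 243 (`Î(k) = −k² ln|k| + (½−γ_E)k²`, the small-`x` limit); Watson, Bessel Functions §6.22] -/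
theorem stub_liaSymbol : LiaSymbolBound := by
  sorry

/-- STUB P5 · `stub_analyticClosing` · L–XL · THE hard stub (two-phase scheme of the file header).  Why it might fail:
(1) PHASE 1 needs the full nonlinear map (self-induction − local induction, partner coupling `~Rb²/(γρ²)`, area-law
slaving at relative order `1/log Γ`) to be `½`-Lipschitz between stadium norms with loss `0.87√(μL_ball)` — the
multiplier bound covers only the straight-filament linearisation; curvature corrections are `O(Rb)` relative and must
not accumulate over `O(log Γ)` steps; (2) PHASE 2 needs the joint linear right inverse with a polynomial bound INCLUDING
the stagnation box, where only the `O(1)` hyperbolic normal block controls core-scale envelopes — a genuine (linear,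
one-dimensional, semiclassical) lemma not in print; (3) the designed far arms must keep the slip zero unique globally
(`w > 0` outward) — an inequality on the design, believed harmless.  Dead line avoided: no sharp `L^∞` three-regime
estimate is needed (the registered line's S2 risk), only crude polynomial bounds after super-exponential pre-convergence. -/
theorem stub_analyticClosing : AnalyticNewtonClosing := by
  sorry

/-! ## §5  Certification and composition (sorry-free) -/

/-- The route child decl IS the structured form (definitional). -/
theorem tangentSkeletonNearStraight_iff :
    Summit.NavierStokesRegularity.NavierStokesRegularity.Theses.FilamentSkeletonRss.TangentSkeletonNearStraight ↔
      TangentSkeletonNearStraightP :=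
  Iff.rfl

/-- The strengthened output implies the child (drop the two analyticity conjuncts). Real proof. -/
theorem tangentSkeletonNearStraightP_of_analytic (h : TangentSkeletonAnalytic) : TangentSkeletonNearStraightP := by
  intro N δ ρ Λ Rw θ₀ mw p t γ α s₀ hN hδ hρ hRw hθ₀ hmw hSD hGP
  obtain ⟨δ', ρ', K, Λ', Rw', cg, θ₀', KA, Rb₁, cs, hδ', hρ', hRw', hcg, hθ₀', hRb₁, hcs, hKρ, hfam⟩ :=
    h N δ ρ Λ Rw θ₀ mw p t γ α s₀ hN hδ hρ hRw hθ₀ hmw hSD hGP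
  refine ⟨δ', ρ', K, Λ', Rw', cg, θ₀', KA, Rb₁, hδ', hρ', hRw', hcg, hθ₀', hRb₁, hKρ, ?_⟩
  intro Rb hRb hRb₁'
  obtain ⟨Γ₂, hΓ⟩ := hfam Rb hRb hRb₁'
  refine ⟨Γ₂, fun Γ hΓ' => ?_⟩
  obtain ⟨X, w, c, Aa, hflat, hns, -, -⟩ := hΓ Γ hΓ'
  exact ⟨X, w, c, Aa, hflat, hns⟩

/-- COMPOSITION over the three stub STATEMENTS (real proof, no stub constant used), concluding the STRUCTURED form (the route
decl is reserved for the skeleton theorem below, so that exactly one theorem of this file concludes the child by name). -/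
theorem tangentSkeletonNearStraightP_of_hyps (h2 : StripPropagation) (h3 : LiaSymbolBound) (h5 : AnalyticNewtonClosing) :
    TangentSkeletonNearStraightP :=
  tangentSkeletonNearStraightP_of_analytic (h5 h2 h3)

/-- THE SKELETON THEOREM (the only theorem of this file concluding the child decl by name; A12 shape — the three registered
stubs used by name, all glue in the closed `tangentSkeletonNearStraightP_of_hyps` and `tangentSkeletonNearStraight_iff`):
closed modulo the three stub `sorry`s only. -/
theorem TangentSkeletonNearStraight_of :
    Summit.NavierStokesRegularity.NavierStokesRegularity.Theses.FilamentSkeletonRss.TangentSkeletonNearStraight :=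
  tangentSkeletonNearStraight_iff.mpr
    (tangentSkeletonNearStraightP_of_hyps stub_stripPropagation stub_liaSymbol stub_analyticClosing)

end Summit.NavierStokesRegularity.NavierStokesRegularity.Cruxes.TangentSkeletonNearStraight.AnalyticStrip
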